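import Summits.KontsevichZagierPeriods.Zeta5Search.WedgeDictionaryCoeffV
import HarnessLib

/-!
# Level descent at the same level: the ζ(5)-free wedge as an explicit combination of degenerate-shape dual series (CONJECTURE LD@N)

HONEST FRAMING: systematic search; no irrationality claim unless certified.

OUR work (Summit side; planner gen-1 g6, 2026-08-20; memo `pub-zeta5-gen-1/D2-PPART-MECHANISM-g6.md`; exact scripts
`code/gen1/g6/`, reference implementation `e13_closed.py`).  STATEMENTS ONLY (three `@[conjecture]` defs and their data);
nothing is proved here and nothing here bears on irrationality: all three conjectures are identities between rational numbers.

With `U = coeffU`, `W = coeffW`, `V = coeffV` (`F̃₇(b) = U ζ(5) + W ζ(3) − V`, `WedgeDictionary`), `N = b₀`,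
`c_jk := N − b_j − b_k`, `d := 3N − Σ_j b_j` (`dOf`), the DEGENERATE SHAPES `(N; N+1, 0, b₃, b₄, b₅, b₆, b₇ − i)` (`degShape`;
the slot pair `(N+1, 0)` contributes `((x)_{N+1})²` to `numPoly`, so these are level-5 — ζ(3)-only — series written as
level-7 objects; `InBox` allows the slot value `N+1`) and the explicit weights (`ldWeight`)

  `Ω_i(b) = 2·(−1)^{c₁₆+c₂₆+i+Σ_j b_j} · b₁! b₂! b₇! d! · ∏_{j=3}^{6} (c_j7+i)!/c_j7!`
  `         / ( ∏_{r∈{1,2}} ∏_{j=3}^{6} c_rj! · i! (c₁₂−i)! (b₇−i)! (b₁−b₇+i)! (b₂−b₇+i)! (d−c₁₂+i)! )`,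

**CONJECTURE LD@N (INTERNALLY MINTED — exact instances only):** for `b` with `0 ≤ b_j`, `2b_j ≤ N`, `d ≥ 0` and the range
condition `c₁₂ ≤ b₇ ∧ c₁₂ ≤ d + max(0, b₇−b₁, b₇−b₂)`, every `j ∈ {1,…,7}` and `b′ = b + e_j`:

  `U(b)·W(b′) − U(b′)·W(b) = Σ_{i=i₋}^{i₊} Ω_i(b)·W(degShape b i)`   (`levelDescentW`, the ζ(3)-row),
  `U(b)·V(b′) − U(b′)·V(b) = Σ_{i=i₋}^{i₊} Ω_i(b)·V(degShape b i)`   (`levelDescentV`, the constant row = the P̂-part of the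
  wedge dictionary in dual-intrinsic, ρ-free form),  `i₋ = max(0, b₇−b₁, b₇−b₂)`, `i₊ = min(c₁₂, b₇)`.

(`U(degShape b i) = 0`: pole orders ≤ 4.)  Evidence (exact rational arithmetic, 0 counterexamples): 60/60 random box points
N ≤ 10, 12/12 with N = 11..14, 45/45 on the faces d ∈ {0,1,2}, 26/26 with a second, code-disjoint implementation of U, W, V
built from the Lean definitions (`code/gen1/g5/cfw3_ref.py`), the face sub-case `c₁₂ = 0 ⇒ Ω₀ = U(b)` 60/60; and, upstream,
40/40 + 20/20 matches against two Brown–Zudilin-side implementations of (22) (gen-1 g2).  PROVENANCE: it is Brown–Zudilin's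
P̂-formula (22) (in its residue range `p₄+q₄ ≤ p₃ ⇔ c₁₂ ≤ b₇`) transported to the dual side by Zudilin's `J₃ = λ·F̃₅`
(`Zudilin2002.WellPoisedIntegrals.vwp_eq_integral_of_pos`, k = 3), the Rhin–Viola/Bailey invariance of `F̃₅(B)/(∏B_j!·(2B₀−ΣB_j)!)`
(Zudilin, JTNB 16 (2004), §5 Lemmas 7–8) and the termwise identity `F̃₅(N; B′) = F̃₇(N; N+1, 0, B′)`.  Beyond the clause
`c₁₂ ≤ b₇` the ζ(3)-row holds unchanged (95/95 + 45/45; `levelDescentW` is stated without that clause) and the constant row holds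
with the REGULARISED boundary terms `E_i = ldBoundary b i`, `b₇ < i ≤ c₁₂`, subtracted (`levelDescentVFull`; 45/45; the dual mirror of
the boundary-corrected (22′) of gen-1 g2); with a free choice of the slot triple this covers 100 % of the shapes for N = 6, 8, 10
and 1695/1697 for N = 12.  The only remaining restriction is `c₁₂ − d ≤ i₋` (regular shapes must converge).
What this is NOT: a theorem, or a statement about irrationality.
-/

open Finset

namespace Summit.KontsevichZagierPeriods.Zeta5Search.WedgeDictionary

open Summit.KontsevichZagierPeriods.Zeta5Search.DualSeries

/-- The degenerate shape `(b₀; b₀+1, 0, b₃, b₄, b₅, b₆, b₇ − i)` (slots 1, 2 replaced by `b₀+1, 0`; slot 7 lowered by `i`). -/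
def degShape (b : ℕ → ℤ) (i : ℤ) : ℕ → ℤ := fun s =>
  if s = 1 then b 0 + 1 else if s = 2 then 0 else if s = 7 then b 7 - i else b s

/-- Factorial of the natural truncation of an integer, as a rational number (all arguments are `≥ 0` in the conjectures' range). -/
def facQ (z : ℤ) : ℚ := (z.toNat.factorial : ℚ)

/-- The level-descent weight `Ω_i(b)` (module docstring), `c j k = b₀ − b_j − b_k`, `d = dOf b`. -/
def ldWeight (b : ℕ → ℤ) (i : ℤ) : ℚ :=
  let c : ℕ → ℕ → ℤ := fun j k => b 0 - b j - b k
  2 * (-1 : ℚ) ^ (c 1 6 + c 2 6 + i + ∑ j ∈ range 7, b (j + 1)) *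
    (facQ (b 1) * facQ (b 2) * facQ (b 7) * facQ (dOf b) * ∏ j ∈ Icc 3 6, (facQ (c j 7 + i) / facQ (c j 7))) /
    ((∏ j ∈ Icc 3 6, (facQ (c 1 j) * facQ (c 2 j))) * facQ i * facQ (c 1 2 - i) * facQ (b 7 - i) *
      facQ (b 1 - b 7 + i) * facQ (b 2 - b 7 + i) * facQ (dOf b - c 1 2 + i))

/-- **CONJECTURE LD@N, ζ(3)-row (INTERNALLY MINTED — exact instances only; module docstring).**  No range clause
`c₁₂ ≤ b₇` is needed for this row (observed 95/95 + 45/45 beyond it); only `c₁₂ − d ≤ i₋`. -/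
@[conjecture] def levelDescentW : Prop :=
  ∀ (b : ℕ → ℤ) (j : ℕ), j ∈ Icc 1 7 → InBox b → (∀ k ∈ Icc 1 7, 2 * b k ≤ b 0) → 0 ≤ dOf b →
    b 0 - b 1 - b 2 ≤ dOf b + max 0 (max (b 7 - b 1) (b 7 - b 2)) →
    coeffU b * coeffW (Function.update b j (b j + 1)) - coeffU (Function.update b j (b j + 1)) * coeffW b =
      ∑ i ∈ Icc (max 0 (max (b 7 - b 1) (b 7 - b 2))) (min (b 0 - b 1 - b 2) (b 7)),
        ldWeight b i * coeffW (degShape b i)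

/-- **CONJECTURE LD@N, constant row = the P̂-part of the wedge dictionary in dual-intrinsic form (INTERNALLY MINTED —
exact instances only; module docstring).** -/
@[conjecture] def levelDescentV : Prop :=
  ∀ (b : ℕ → ℤ) (j : ℕ), j ∈ Icc 1 7 → InBox b → (∀ k ∈ Icc 1 7, 2 * b k ≤ b 0) → 0 ≤ dOf b →
    b 0 - b 1 - b 2 ≤ b 7 → b 0 - b 1 - b 2 ≤ dOf b + max 0 (max (b 7 - b 1) (b 7 - b 2)) →
    coeffU b * coeffV (Function.update b j (b j + 1)) - coeffU (Function.update b j (b j + 1)) * coeffV b =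
      ∑ i ∈ Icc (max 0 (max (b 7 - b 1) (b 7 - b 2))) (min (b 0 - b 1 - b 2) (b 7)),
        ldWeight b i * coeffV (degShape b i)

/-- Rising factorial `(x)_n = x (x+1) ⋯ (x+n−1)` over `ℚ`. -/
def pochQ (x : ℚ) (n : ℕ) : ℚ := ∏ t ∈ range n, (x + t)

/-- The level-5 kernel of the slots `b₃..b₆` at the integer point `x`:
`R₅(x; b₃,b₄,b₅,b₆) = (2x+N)·∏_{j=3}^{6} (x)_{b_j} (x+N+1−b_j)_{b_j} / ((x)_{N+1})⁴`. -/
def kernel5 (b : ℕ → ℤ) (x : ℕ) : ℚ :=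
  (2 * (x : ℚ) + b 0) / pochQ x ((b 0).toNat + 1) ^ 4 *
    ∏ j ∈ Icc 3 6, pochQ x (b j).toNat * pochQ ((x : ℚ) + b 0 + 1 - b j) (b j).toNat

/-- `Ω̄_i(b)`: the weight `Ω_i(b)` with its vanishing factor `1/(b₇−i)!` deleted (used for `i > b₇`). -/
def ldWeightBar (b : ℕ → ℤ) (i : ℤ) : ℚ :=
  let c : ℕ → ℕ → ℤ := fun j k => b 0 - b j - b k
  2 * (-1 : ℚ) ^ (c 1 6 + c 2 6 + i + ∑ j ∈ range 7, b (j + 1)) *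
    (facQ (b 1) * facQ (b 2) * facQ (b 7) * facQ (dOf b) * ∏ j ∈ Icc 3 6, (facQ (c j 7 + i) / facQ (c j 7))) /
    ((∏ j ∈ Icc 3 6, (facQ (c 1 j) * facQ (c 2 j))) * facQ i * facQ (c 1 2 - i) *
      facQ (b 1 - b 7 + i) * facQ (b 2 - b 7 + i) * facQ (dOf b - c 1 2 + i))

/-- The REGULARISED boundary term `E_i(b)` for `i > b₇` (`μ = i − b₇`): the finite limit of `Ω_i·F̃₇(shape_i)` along the analytic
family `b₇ − i ↦ b₇ − i + ε` (simple zero of the weight against the simple pole of the degenerate series with a negative slot):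
`E_i = Ω̄_i·(μ−1)!·Σ_{x=1}^{μ} (−1)^{x−1} R₅(x; b₃..b₆) / ((μ−x)! (x−1)! (x+N+1)_μ)`.  A finite sum of rationals. -/
def ldBoundary (b : ℕ → ℤ) (i : ℤ) : ℚ :=
  let μ : ℕ := (i - b 7).toNat
  ldWeightBar b i * (Nat.factorial (μ - 1) : ℚ) *
    ∑ x ∈ Icc 1 μ, (-1 : ℚ) ^ (x - 1) * kernel5 b x /
      ((Nat.factorial (μ - x) : ℚ) * (Nat.factorial (x - 1) : ℚ) * pochQ ((x : ℚ) + b 0 + 1) μ)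

/-- **THEOREM LD@N⁺ (VFull) — PROVED** (`levelDescentVFull_holds`, `WedgeDictionaryLevelDescentVFullRel3`, p227810 = `levelDescentVFull_of_rel3`
p222037 applied to REL-3 `ldY_rel3_holds`; chain p219090 … p227810; internally minted, first checked on exact instances 45/45 beyond the range
`c₁₂ ≤ b₇`; the `@[conjecture]` tag is kept only as the obligation-node marker): constant row on (essentially) the whole box, where the regularised
boundary terms `E_i`, `b₇ < i ≤ c₁₂`, enter with a MINUS sign; it restricts to `levelDescentV` when `c₁₂ ≤ b₇`.  The dual mirror of the
boundary-corrected Brown–Zudilin formula (22′) (gen-1 g2). -/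
@[conjecture] def levelDescentVFull : Prop :=
  ∀ (b : ℕ → ℤ) (j : ℕ), j ∈ Icc 1 7 → InBox b → (∀ k ∈ Icc 1 7, 2 * b k ≤ b 0) → 0 ≤ dOf b →
    b 0 - b 1 - b 2 ≤ dOf b + max 0 (max (b 7 - b 1) (b 7 - b 2)) →
    coeffU b * coeffV (Function.update b j (b j + 1)) - coeffU (Function.update b j (b j + 1)) * coeffV b =
      (∑ i ∈ Icc (max 0 (max (b 7 - b 1) (b 7 - b 2))) (min (b 0 - b 1 - b 2) (b 7)),
        ldWeight b i * coeffV (degShape b i)) -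
      ∑ i ∈ Icc (b 7 + 1) (b 0 - b 1 - b 2), ldBoundary b i

/- Transcription checks of `ldWeight` and `ldBoundary` against the reference implementations `code/gen1/g6/e13_closed.py` (`Om`) and
`code/gen1/g6/e21_boundary.py` (`E`), RUN IN STAGING (gen-1 g6: `lean check` rc 0 with the block below uncommented; it uses
`native_decide`, hence is kept out of the filed version to stay on the standard axioms):

  def ldTestB : ℕ → ℤ := fun s => [(9 : ℤ), 4, 2, 2, 3, 1, 3, 3].getD s 0
  def ldTestB' : ℕ → ℤ := fun s => [(6 : ℤ), 3, 2, 3, 3, 0, 2, 3].getD s 0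
  def ldTestC : ℕ → ℤ := fun s => [(9 : ℤ), 1, 4, 0, 4, 0, 3, 1].getD s 0
  def ldTestC' : ℕ → ℤ := fun s => [(4 : ℤ), 1, 1, 0, 0, 2, 0, 0].getD s 0
  example : ldWeight ldTestB 1 = -1 / 11520 ∧ ldWeight ldTestB 2 = 35 / 4608 ∧ ldWeight ldTestB 3 = -245 / 3456 ∧
      ldWeight ldTestB' 1 = 2 := by native_decide
  example : ldBoundary ldTestC 2 = 13 / 6263239585283702784000000000 ∧
      ldBoundary ldTestC 3 = -563 / 169107468802659975168000000000 ∧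
      ldBoundary ldTestC 4 = 1333 / 789168187745746550784000000000 ∧
      ldBoundary ldTestC' 1 = -1 / 161243136 ∧ ldBoundary ldTestC' 2 = 41 / 7739670528 := by native_decide
-/

end Summit.KontsevichZagierPeriods.Zeta5Search.WedgeDictionary
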